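import Summits.QuantumFields.YangMills.Theorems.RectangleDominationShallowEngine
import Summits.QuantumFields.YangMills.Theorems.RandomisedStokesChaosExponents

/-!
# Route `RandomisedStokes` (LINE 18 of seat `ym-r3-idea-2`; rung R3 of LADDER-YM = `T3YM3TorusStatement.YM3TorusSU2`, a RECORD
# rung — not d = 4, not the Clay statement) — THE OFF-SLIVER ENGINE of the glue `HistoryTailOfChaosL` (support item
# stmt-QuantumFields-23887), part 1b: the union-bound-plus-chaos split, the rectangle count, one rectangle event off the sliver

The glue `RectangleTailL → ChaosSuppressedDominationL → ThinDeepWindowTailL → UnitScaleTilt.HistoryTailL` needs, OFF THE SLIVER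
`(j+1)^N ≤ p(g_h)` (`h = K − j`, `p = p_{b₀,p₀}`), a per-plaquette tail of the BARE event `{θ_{b₀}(h) ≤ |Ū^{j}(∂p) − 1|}` with a
log-square rate `exp(−(1 + log g_h⁻¹)²)`.  With `η = θ_{b₀}(h)/(2D(j+1))` the event lies in `{not profile-flat} ∪ {flat ∧ D(j+1)η <
|Ū^{j}(∂p) − 1|}` (`real_bare_le_count_mul_add`); the first part is a union over `≤ 288R²L^{3m}(j+1)L^{3K+2j}` rectangle events
(`count_le_offSliver`), each bounded by the rectangle tail (`rect_event_le_offSliver`, exponent lemma `offSliver_rect_exponent`: the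
`j`-entropy is paid inside the stretched exponent because `(j+1) ≤ p^{1/N}` and `N > 3/2 + 1/α`); the second by the chaos crux
(exponent lemma `offSliver_chaos_exponent`: `η/g_h² = p·e^{ℓ}/(2D(j+1))`, `N > 1 + 1/α_X`).  Part 2
(`RandomisedStokesOffSliverEngine.lean`) assembles the off-sliver per-plaquette tail; the glue file lands the item BY NAME.

HONEST FRAMING: bookkeeping only (real analysis + a union bound).  The cruxes `RectangleTailL` (stmt-23864),
`ChaosSuppressedDominationL` (stmt-23885), `ThinDeepWindowTailL` (stmt-23919) stay OPEN; nothing here proves `HistoryTailL`, the rung R3,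
or anything about the Yang–Mills mass gap.  No `def`, no `sorry`.

References: T. Bałaban, CMP **102** (1985) 255–275 [Balaban1985UV3] ((3),(7) p.256–257); C. King, CMP **103** (1986) 323–349 [King1986].
-/

set_option autoImplicit false

noncomputable section

open MeasureTheory
open scoped BigOperators
open Literature.MathematicalPhysics.QuantumFieldTheory.Balaban1983to89
open Literature.MathematicalPhysics.QuantumFieldTheory.Balaban1983to89.T3ContinuumYM3Torus
open Literature.MathematicalPhysics.QuantumFieldTheory.Balaban1983to89.T3UnitScaleTilt
open Summit.QuantumFields.YangMills.Theorems.RectangleDominationShallow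

namespace Summit.QuantumFields.YangMills.Theorems.RandomisedStokesChaos

/-! ## §2 The split: not profile-flat (a union of rectangle events) or flat with a large averaged plaquette (the chaos event) -/

section Split

/-- **UNION BOUND PLUS CHAOS EVENT** (one cut-off `K`, one height `j`, one plaquette `p`; any finite measure).  If
`D(j+1)η < θ`, the bare event `{θ ≤ |Ū^{j}(∂p) − 1|}` lies in the union of the rectangle events `{η√(L^i/L^j) ≤ |U(∂rect) − 1|}`
(`i ≤ j`, corners `x`, directions `μ ≠ ν`, sides `a, b ≤ ⌊RL^j⌋`) and of the CHAOS event «every such rectangle is profile-flat and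
`D(j+1)η < |Ū^{j}(∂p) − 1|`»; so if each rectangle event has mass `≤ B` (`B ≥ 0`) the bare event has mass
`≤ (j+1)·#sites·9·(⌊RL^j⌋+1)²·B + (mass of the chaos event)`. [cite: Balaban1985UV3, (7) p.257] -/
theorem real_bare_le_count_mul_add (F : T3Family) {K j : ℕ} (p : Plaq (F.P K) j)
    (μm : Measure (GaugeField (F.P K) 0 (Matrix.specialUnitaryGroup (Fin 2) ℂ))) [IsFiniteMeasure μm]
    {θ η D R B : ℝ} (hR : 0 ≤ R) (hB : 0 ≤ B) (hθ : D * ((j : ℝ) + 1) * η < θ)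
    (hrect : ∀ (i a b : ℕ) (x : Site (F.P K) 0) (μ ν : Fin (F.P K).d), μ ≠ ν → i ≤ j → 1 ≤ a → 1 ≤ b →
      2 * (a + b) < (F.P K).sitesPerDir 0 → ((a : ℝ) + b) ≤ R * (F.L : ℝ) ^ i →
      μm.real {U | η * Real.sqrt ((F.L : ℝ) ^ i / (F.L : ℝ) ^ j) ≤
        GaugeGroup.dist1 (Missing.pathHol U (Missing.rectLoop x μ ν a b))} ≤ B) :
    μm.real {U | θ ≤ GaugeGroup.dist1 (GaugeField.plaqHol
        (Averaging.iter (fun i => BlockAveraging.blockAvg (P := F.P K) (j := i) T3UnitLawDensityEML.ℰp) j U) p)} ≤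
      (((j + 1) * (Fintype.card (Site (F.P K) 0) *
        (3 * (3 * ((⌊R * (F.L : ℝ) ^ j⌋₊ + 1) * (⌊R * (F.L : ℝ) ^ j⌋₊ + 1))))) : ℕ) : ℝ) * B +
      μm.real {U | (∀ (i a b : ℕ) (x : Site (F.P K) 0) (μ ν : Fin (F.P K).d), μ ≠ ν → i ≤ j → 1 ≤ a → 1 ≤ b →
          2 * (a + b) < (F.P K).sitesPerDir 0 → ((a : ℝ) + b) ≤ R * (F.L : ℝ) ^ i →
          GaugeGroup.dist1 (Missing.pathHol U (Missing.rectLoop x μ ν a b)) ≤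
            η * Real.sqrt ((F.L : ℝ) ^ i / (F.L : ℝ) ^ j)) ∧
        D * ((j : ℝ) + 1) * η < GaugeGroup.dist1 (GaugeField.plaqHol
          (Averaging.iter (fun i => BlockAveraging.blockAvg (P := F.P K) (j := i) T3UnitLawDensityEML.ℰp) j U) p)} := by
  classical
  have hLr1 : (1 : ℝ) ≤ F.L := by exact_mod_cast F.hL.2.le
  -- the index set of rectangles and the rectangle events
  obtain ⟨N, hN_def⟩ : ∃ N : ℕ, N = ⌊R * (F.L : ℝ) ^ j⌋₊ := ⟨_, rfl⟩
  rw [← hN_def]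
  obtain ⟨S, hS_def⟩ : ∃ S : Finset (ℕ × Site (F.P K) 0 × Fin (F.P K).d × Fin (F.P K).d × ℕ × ℕ),
      S = Finset.range (j + 1) ×ˢ (Finset.univ ×ˢ (Finset.univ ×ˢ (Finset.univ ×ˢ
        (Finset.range (N + 1) ×ˢ Finset.range (N + 1))))) := ⟨_, rfl⟩
  obtain ⟨E, hE_def⟩ : ∃ E : ℕ × Site (F.P K) 0 × Fin (F.P K).d × Fin (F.P K).d × ℕ × ℕ →
      Set (GaugeField (F.P K) 0 (Matrix.specialUnitaryGroup (Fin 2) ℂ)),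
      E = fun s => {U | (s.2.2.1 ≠ s.2.2.2.1 ∧ s.1 ≤ j ∧ 1 ≤ s.2.2.2.2.1 ∧ 1 ≤ s.2.2.2.2.2 ∧
          2 * (s.2.2.2.2.1 + s.2.2.2.2.2) < (F.P K).sitesPerDir 0 ∧
          ((s.2.2.2.2.1 : ℝ) + s.2.2.2.2.2) ≤ R * (F.L : ℝ) ^ s.1) ∧
        η * Real.sqrt ((F.L : ℝ) ^ s.1 / (F.L : ℝ) ^ j) ≤
          GaugeGroup.dist1 (Missing.pathHol U
            (Missing.rectLoop s.2.1 s.2.2.1 s.2.2.2.1 s.2.2.2.2.1 s.2.2.2.2.2))} := ⟨_, rfl⟩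
  -- (i) not flat ⇒ some rectangle event; flat ⇒ the chaos event
  have hsub : {U : GaugeField (F.P K) 0 (Matrix.specialUnitaryGroup (Fin 2) ℂ) | θ ≤ GaugeGroup.dist1
      (GaugeField.plaqHol (Averaging.iter (fun i => BlockAveraging.blockAvg (P := F.P K) (j := i)
        T3UnitLawDensityEML.ℰp) j U) p)} ⊆ (⋃ s ∈ S, E s) ∪
      {U | (∀ (i a b : ℕ) (x : Site (F.P K) 0) (μ ν : Fin (F.P K).d), μ ≠ ν → i ≤ j → 1 ≤ a → 1 ≤ b →
          2 * (a + b) < (F.P K).sitesPerDir 0 → ((a : ℝ) + b) ≤ R * (F.L : ℝ) ^ i →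
          GaugeGroup.dist1 (Missing.pathHol U (Missing.rectLoop x μ ν a b)) ≤
            η * Real.sqrt ((F.L : ℝ) ^ i / (F.L : ℝ) ^ j)) ∧
        D * ((j : ℝ) + 1) * η < GaugeGroup.dist1 (GaugeField.plaqHol
          (Averaging.iter (fun i => BlockAveraging.blockAvg (P := F.P K) (j := i) T3UnitLawDensityEML.ℰp) j U) p)} := by
    intro U hU
    rw [Set.mem_setOf_eq] at hU
    by_cases hflat : ∀ (i a b : ℕ) (x : Site (F.P K) 0) (μ ν : Fin (F.P K).d), μ ≠ ν → i ≤ j → 1 ≤ a → 1 ≤ b →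
        2 * (a + b) < (F.P K).sitesPerDir 0 → ((a : ℝ) + b) ≤ R * (F.L : ℝ) ^ i →
        GaugeGroup.dist1 (Missing.pathHol U (Missing.rectLoop x μ ν a b)) ≤
          η * Real.sqrt ((F.L : ℝ) ^ i / (F.L : ℝ) ^ j)
    · exact Or.inr ⟨hflat, lt_of_lt_of_le hθ hU⟩
    · left
      push Not at hflat
      obtain ⟨i, a, b, x, μ, ν, hμν, hij, ha, hb, hab, habR, hlt⟩ := hflat
      have hRLj : ((a : ℝ) + b) ≤ R * (F.L : ℝ) ^ j :=
        habR.trans (mul_le_mul_of_nonneg_left (pow_le_pow_right₀ hLr1 hij) hR)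
      have ha0 : (0 : ℝ) ≤ a := Nat.cast_nonneg a
      have hb0 : (0 : ℝ) ≤ b := Nat.cast_nonneg b
      have hRL0 : 0 ≤ R * (F.L : ℝ) ^ j := by positivity
      have haN : a ≤ N := by rw [hN_def]; exact (Nat.le_floor_iff hRL0).mpr (by linarith)
      have hbN : b ≤ N := by rw [hN_def]; exact (Nat.le_floor_iff hRL0).mpr (by linarith)
      have hs : (i, x, μ, ν, a, b) ∈ S := by
        rw [hS_def]
        simp only [Finset.mem_product, Finset.mem_range, Finset.mem_univ, true_and]
        omega
      refine Set.mem_iUnion₂.mpr ⟨(i, x, μ, ν, a, b), hs, ?_⟩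
      rw [hE_def]
      exact ⟨⟨hμν, hij, ha, hb, hab, habR⟩, hlt.le⟩
  -- (ii) each rectangle event has mass at most `B`
  have hE : ∀ s ∈ S, μm.real (E s) ≤ B := by
    rintro ⟨i, x, μ, ν, a, b⟩ -
    by_cases hv : (μ ≠ ν ∧ i ≤ j ∧ 1 ≤ a ∧ 1 ≤ b ∧ 2 * (a + b) < (F.P K).sitesPerDir 0 ∧
        ((a : ℝ) + b) ≤ R * (F.L : ℝ) ^ i)
    · obtain ⟨hμν, hij, ha, hb, hab, habR⟩ := hv
      have hEeq : E (i, x, μ, ν, a, b) = {U | η * Real.sqrt ((F.L : ℝ) ^ i / (F.L : ℝ) ^ j) ≤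
          GaugeGroup.dist1 (Missing.pathHol U (Missing.rectLoop x μ ν a b))} := by
        ext U
        rw [hE_def]
        simp only [Set.mem_setOf_eq]
        exact ⟨fun hU => hU.2, fun hU => ⟨⟨hμν, hij, ha, hb, hab, habR⟩, hU⟩⟩
      rw [hEeq]
      exact hrect i a b x μ ν hμν hij ha hb hab habR
    · have hsub0 : E (i, x, μ, ν, a, b) ⊆ ∅ := by
        intro U hU
        rw [hE_def] at hU
        simp only [Set.mem_setOf_eq] at hU
        exact hv hU.1
      exact (measureReal_mono hsub0 (measure_ne_top _ _)).trans (by rw [measureReal_empty]; exact hB)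
  -- (iii) the count and the union bound
  have hScard : S.card = (j + 1) * (Fintype.card (Site (F.P K) 0) * (3 * (3 * ((N + 1) * (N + 1))))) := by
    rw [hS_def, Finset.card_product, Finset.card_product, Finset.card_product, Finset.card_product,
      Finset.card_product]
    simp only [Finset.card_range, Finset.card_univ, Fintype.card_fin]
    rfl
  rw [← hScard]
  refine (measureReal_mono hsub (measure_ne_top _ _)).trans ((measureReal_union_le _ _).trans ?_)
  exact add_le_add (measureReal_le_card_mul μm S E subset_rfl hE) le_rfl

end Split

/-! ## §3 The rectangle count at any height -/

section Count

/-- **THE RECTANGLE COUNT AT ANY HEIGHT**: `(j+1)·#sites(T^{(K)}_0)·9·(⌊RL^j⌋+1)² ≤ 288·R²·L^{3m}·((j+1)·(L^K)³·(L^j)²)`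
(`#sites = (2L^{m+K})³`, `⌊RL^j⌋ + 1 ≤ 2RL^j` for `R ≥ 2`). [cite: Balaban1985UV3, (1)-(3) p.256] -/
theorem count_le_offSliver (F : T3Family) {K j : ℕ} {R : ℝ} (hR : 2 ≤ R) :
    (((j + 1) * (Fintype.card (Site (F.P K) 0) *
        (3 * (3 * ((⌊R * (F.L : ℝ) ^ j⌋₊ + 1) * (⌊R * (F.L : ℝ) ^ j⌋₊ + 1))))) : ℕ) : ℝ) ≤
      288 * R ^ 2 * (F.L : ℝ) ^ (3 * F.m) * (((j : ℝ) + 1) * ((F.L : ℝ) ^ K) ^ 3 * ((F.L : ℝ) ^ j) ^ 2) := by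
  have hLr1 : (1 : ℝ) ≤ F.L := by exact_mod_cast F.hL.2.le
  have hLr0 : (0 : ℝ) < F.L := by linarith
  have hR0 : 0 < R := by linarith
  obtain ⟨N, hN_def⟩ : ∃ N : ℕ, N = ⌊R * (F.L : ℝ) ^ j⌋₊ := ⟨_, rfl⟩
  rw [← hN_def]
  have hc1 : Fintype.card (Site (F.P K) 0) = (2 * F.L ^ (F.m + K)) ^ 3 := by
    rw [show Fintype.card (Site (F.P K) 0) =
        Fintype.card (Fin (F.P K).d → ZMod ((F.P K).sitesPerDir 0)) from rfl,
      Fintype.card_fun, ZMod.card, Fintype.card_fin]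
    rfl
  have hLj1 : (1 : ℝ) ≤ (F.L : ℝ) ^ j := one_le_pow₀ hLr1
  have e3 : ((N : ℝ) + 1) ≤ 2 * R * (F.L : ℝ) ^ j := by
    have hN : (N : ℝ) ≤ R * (F.L : ℝ) ^ j := by rw [hN_def]; exact Nat.floor_le (by positivity)
    nlinarith
  have hN0 : (0 : ℝ) ≤ (N : ℝ) + 1 := by positivity
  have hNN : ((N : ℝ) + 1) * ((N : ℝ) + 1) ≤ (2 * R * (F.L : ℝ) ^ j) * (2 * R * (F.L : ℝ) ^ j) :=
    mul_le_mul e3 e3 hN0 (by positivity)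
  push_cast
  rw [hc1]
  push_cast
  have h8 : ((2 : ℝ) * (F.L : ℝ) ^ (F.m + K)) ^ 3 = 8 * (F.L : ℝ) ^ (3 * F.m) * ((F.L : ℝ) ^ K) ^ 3 := by ring
  rw [h8]
  have hj0 : (0 : ℝ) ≤ (j : ℝ) + 1 := by positivity
  have hin : (8 * (F.L : ℝ) ^ (3 * F.m) * ((F.L : ℝ) ^ K) ^ 3) * (3 * (3 * (((N : ℝ) + 1) * ((N : ℝ) + 1)))) ≤
      (8 * (F.L : ℝ) ^ (3 * F.m) * ((F.L : ℝ) ^ K) ^ 3) * (3 * (3 * ((2 * R * (F.L : ℝ) ^ j) * (2 * R * (F.L : ℝ) ^ j)))) :=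
    mul_le_mul_of_nonneg_left (by linarith) (by positivity)
  calc ((j : ℝ) + 1) * ((8 * (F.L : ℝ) ^ (3 * F.m) * ((F.L : ℝ) ^ K) ^ 3) * (3 * (3 * (((N : ℝ) + 1) * ((N : ℝ) + 1)))))
      ≤ ((j : ℝ) + 1) * ((8 * (F.L : ℝ) ^ (3 * F.m) * ((F.L : ℝ) ^ K) ^ 3) *
          (3 * (3 * ((2 * R * (F.L : ℝ) ^ j) * (2 * R * (F.L : ℝ) ^ j))))) := mul_le_mul_of_nonneg_left hin hj0
    _ = 288 * R ^ 2 * (F.L : ℝ) ^ (3 * F.m) * (((j : ℝ) + 1) * ((F.L : ℝ) ^ K) ^ 3 * ((F.L : ℝ) ^ j) ^ 2) := by ring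

end Count

/-! ## §4 One rectangle event off the sliver -/

section Rect

/-- **ONE RECTANGLE EVENT OFF THE SLIVER** (any measure on the fine fields of the `K`-th approximation).  Under the rectangle tail at
cut-off `K` (constants `C, A, c, α`, `β_K = (γL^{-K})⁻¹`), for a contractible rectangle with `i ≤ j`, `μ ≠ ν`, `1 ≤ a, b`,
`2(a+b) <` sites per direction and `a + b ≤ R·L^i`, a threshold `0 < η ≤ 1` with `η²β_K = P²L^j/(4D²(j+1)²)`, and the
off-sliver data of `offSliver_rect_exponent` (`(j+1)^N ≤ P`, `u² ≤ P^{2/N}`, `c₂^α P^{α(2−3/N)−2/N} ≥ κ + 1`): the event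
`{η√(L^i/L^j) ≤ |U(∂rect) − 1|}` has mass `≤ C·β_K^A·(RL^j)^A·exp(−(κ(j+1) + u²))`. [cite: Balaban1985UV3, (7) p.257] -/
theorem rect_event_le_offSliver (F : T3Family) {K j i a b A N : ℕ} (x : Site (F.P K) 0) (μ ν : Fin (F.P K).d)
    (μm : Measure (GaugeField (F.P K) 0 (Matrix.specialUnitaryGroup (Fin 2) ℂ)))
    {γ α c C D R P η u κ : ℝ} (hγ : 0 < γ) (hα : 0 < α) (hc : 0 < c) (hC : 0 ≤ C) (hD : 1 ≤ D) (hR : 2 ≤ R)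
    (hP1 : 1 ≤ P) (hN : 0 < N) (hjP : ((j : ℝ) + 1) ^ N ≤ P) (huP : u ^ 2 ≤ P ^ ((2 : ℝ) / N)) (hκ : 0 ≤ κ)
    (hbig : κ + 1 ≤ (c / (4 * D ^ 2 * R * (1 + Real.log R) * (1 + Real.log F.L))) ^ α *
      P ^ (α * (2 - 3 / N) - 2 / N))
    (hη0 : 0 < η) (hη1 : η ≤ 1)
    (hηβ : η ^ 2 * (γ * ((F.L : ℝ)⁻¹) ^ K)⁻¹ = P ^ 2 * (F.L : ℝ) ^ j / (4 * D ^ 2 * ((j : ℝ) + 1) ^ 2))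
    (hRT : ∀ (a b : ℕ) (x : Site (F.P K) 0) (μ ν : Fin (F.P K).d) (t : ℝ), μ ≠ ν → 1 ≤ a → 1 ≤ b →
      2 * (a + b) < (F.P K).sitesPerDir 0 → 0 < t → t ≤ 1 →
      μm.real {U | t ≤ GaugeGroup.dist1 (Missing.pathHol U (Missing.rectLoop x μ ν a b))} ≤
        C * (γ * ((F.L : ℝ)⁻¹) ^ K)⁻¹ ^ A * ((a : ℝ) + b) ^ A *
          Real.exp (-((c * (t ^ 2 * (γ * ((F.L : ℝ)⁻¹) ^ K)⁻¹ /
            (((a : ℝ) + b) * (1 + Real.log ((a : ℝ) + b))))) ^ α)))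
    (hμν : μ ≠ ν) (hij : i ≤ j) (ha : 1 ≤ a) (hb : 1 ≤ b) (hab : 2 * (a + b) < (F.P K).sitesPerDir 0)
    (habR : ((a : ℝ) + b) ≤ R * (F.L : ℝ) ^ i) :
    μm.real {U | η * Real.sqrt ((F.L : ℝ) ^ i / (F.L : ℝ) ^ j) ≤
        GaugeGroup.dist1 (Missing.pathHol U (Missing.rectLoop x μ ν a b))} ≤
      C * (γ * ((F.L : ℝ)⁻¹) ^ K)⁻¹ ^ A * (R * (F.L : ℝ) ^ j) ^ A * Real.exp (-(κ * ((j : ℝ) + 1) + u ^ 2)) := by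
  have hL3 : 3 ≤ F.L := three_le_of_odd F.hL
  have hlogL : (1 : ℝ) ≤ Real.log F.L := one_le_log hL3
  have hLr1 : (1 : ℝ) ≤ F.L := by exact_mod_cast F.hL.2.le
  have hLr0 : (0 : ℝ) < F.L := by linarith
  have hR0 : 0 < R := by linarith
  have hD0 : 0 < D := by linarith
  have hβK0 : 0 ≤ (γ * ((F.L : ℝ)⁻¹) ^ K)⁻¹ := by positivity
  have hratio0 : 0 < (F.L : ℝ) ^ i / (F.L : ℝ) ^ j := by positivity
  have hratio : (F.L : ℝ) ^ i / (F.L : ℝ) ^ j ≤ 1 :=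
    (div_le_one (pow_pos hLr0 j)).mpr (pow_le_pow_right₀ hLr1 hij)
  have ht0 : 0 < η * Real.sqrt ((F.L : ℝ) ^ i / (F.L : ℝ) ^ j) := by positivity
  have ht1 : η * Real.sqrt ((F.L : ℝ) ^ i / (F.L : ℝ) ^ j) ≤ 1 :=
    (mul_le_mul_of_nonneg_left (Real.sqrt_le_one.mpr hratio) hη0.le).trans (by linarith)
  have htail := hRT a b x μ ν _ hμν ha hb hab ht0 ht1
  have hs2 : (2 : ℝ) ≤ (a : ℝ) + b := by
    have ha' : (1 : ℝ) ≤ a := by exact_mod_cast ha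
    have hb' : (1 : ℝ) ≤ b := by exact_mod_cast hb
    linarith
  have habj : ((a : ℝ) + b) ≤ R * (F.L : ℝ) ^ j :=
    habR.trans (mul_le_mul_of_nonneg_left (pow_le_pow_right₀ hLr1 hij) hR0.le)
  -- the identity `t²β_K = P²·L^i/(4D²(j+1)²)`
  have hid : (η * Real.sqrt ((F.L : ℝ) ^ i / (F.L : ℝ) ^ j)) ^ 2 * (γ * ((F.L : ℝ)⁻¹) ^ K)⁻¹ =
      P ^ 2 * (F.L : ℝ) ^ i / (4 * D ^ 2 * ((j : ℝ) + 1) ^ 2) := by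
    have hLj0 : (F.L : ℝ) ^ j ≠ 0 := pow_ne_zero j hLr0.ne'
    calc (η * Real.sqrt ((F.L : ℝ) ^ i / (F.L : ℝ) ^ j)) ^ 2 * (γ * ((F.L : ℝ)⁻¹) ^ K)⁻¹
        = (η ^ 2 * (γ * ((F.L : ℝ)⁻¹) ^ K)⁻¹) * ((F.L : ℝ) ^ i / (F.L : ℝ) ^ j) := by
          rw [mul_pow, Real.sq_sqrt hratio0.le]; ring
      _ = P ^ 2 * (F.L : ℝ) ^ i / (4 * D ^ 2 * ((j : ℝ) + 1) ^ 2) := by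
          rw [hηβ]; field_simp
  rw [hid] at htail
  have hmain := offSliver_rect_exponent (s := (a : ℝ) + b) (Li := (F.L : ℝ) ^ i) (logL := Real.log F.L) hα hc hD
    hR hlogL hP1 hN hjP huP hij (pow_pos hLr0 i) (Real.log_pow _ _) hs2 habR hκ hbig
  have hexp : Real.exp (-((c * (P ^ 2 * (F.L : ℝ) ^ i / (4 * D ^ 2 * ((j : ℝ) + 1) ^ 2) /
      (((a : ℝ) + b) * (1 + Real.log ((a : ℝ) + b))))) ^ α)) ≤ Real.exp (-(κ * ((j : ℝ) + 1) + u ^ 2)) :=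
    Real.exp_le_exp.mpr (neg_le_neg hmain)
  have hpowA : ((a : ℝ) + b) ^ A ≤ (R * (F.L : ℝ) ^ j) ^ A := pow_le_pow_left₀ (by positivity) habj A
  refine htail.trans ?_
  exact mul_le_mul (mul_le_mul_of_nonneg_left hpowA (by positivity)) hexp (Real.exp_nonneg _) (by positivity)

end Rect

end Summit.QuantumFields.YangMills.Theorems.RandomisedStokesChaos

end
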